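import Literature.Analysis.FunctionSpaces.TorusPatching
import Literature.Analysis.FunctionSpaces.HolderInterpolation
import Literature.Analysis.FunctionSpaces.TorusCalculus
import HarnessLib

/-!
# Calculus of smoothly patched fields: cellwise derivatives and `C^{k,α}` scaling

Trunk: Sobolev (`Literature/Analysis/FunctionSpaces`). The scaling analysis of
Alberti–Crippa–Mazzucato 2019, Lemma 18 (Step 1: `‖∇ᵏu(t)‖_∞ = λ^{n(1-k)} max_j ‖∇ᵏ u^j‖_∞`
for the field patched from blocks `u^j` rescaled to the squares of `𝒯_{λⁿ}`, Step 2: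
interpolation) and Bruè–De Lellis 2023, Thm. 4.1 (a)/(4.10) (`‖·‖_{C^α} ≤ C 5^{(α-1)n}`), for a
field `W = Torus.patchTorus m ι G` on `T^d` that is KNOWN to be smooth (the smoothness across
the interfaces being the hypothesis `Torus.IsSmooth W`, cf. ACM Ass. 6.3):

* `Torus.fderiv_lift_patchTorus_of_mem_latticeCell` — on every half-open cell `Q_κ`
  (interfaces included, by continuity from the open cell):
  `D(lift W)(y) = m • DG_{ι(κ mod m)}(m • y - κ)`; on the torus,
  `Torus.fderiv W x = m • D G_{ι ⌊m·repr x⌋}(cellCoord m (repr x))` (`Torus.fderiv_patchTorus`);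
* `Torus.norm_iteratedFDeriv_lift_patchTorus_le` — `‖Dⁱ(lift W)(y)‖ ≤ mⁱ Mᵢ` everywhere if
  `‖Dⁱ G_l(z)‖ ≤ Mᵢ` on the fundamental cube (chain rule in the open cells,
  `norm_iteratedFDeriv_rescale_le`, and density of the open cells);
* `Torus.eContDiffHolderNorm_patchTorus_le` — the **`C^{j,r}` scaling bound**
  `‖W‖_{C^{j,r}(T^d)} ≤ m^{j+r} (Σ_{i ≤ j} Mᵢ + M_{j+1} + 2 M_j)`
  (`eContDiffHolderNorm_le_of_norm_iteratedFDeriv_le` at scale `δ = m⁻¹`).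

## References

* G. Alberti, G. Crippa, A. L. Mazzucato, *Exponential self-similar mixing by incompressible
  flows*, J. Amer. Math. Soc. 32 (2019), Lemma 18 and its proof, Rem. 20 (iii).
* E. Bruè, C. De Lellis, *Anomalous dissipation for the forced 3D Navier–Stokes equations*,
  Comm. Math. Phys. 400 (2023), Thm. 4.1 (a), (4.9)–(4.10).
-/

noncomputable section

open MeasureTheory Set Filter
open scoped Topology NNReal ENNReal ContDiff

namespace Literature.Analysis.FunctionSpaces

namespace Torus

variable {d : Type*} [Fintype d] [DecidableEq d]
variable {I : Type*} {X : Type*} [NormedAddCommGroup X] [NormedSpace ℝ X]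
variable {m : ℕ} {ι : (d → ℤ) → I} {G : I → EuclideanSpace ℝ d → X}

/-! ## First derivatives on the cells -/

/-- **Cellwise derivative of a smoothly patched field.** If the blocks are `C¹` and the patched
field `W = patchTorus m ι G` is `C¹` on the torus, then on every half-open cell `Q_κ` of `ℝ^d`
(interfaces included) `D(lift W)(y) = m • D G_{ι(κ mod m)}(m • y - κ)`: in the open cell this is
the chain rule for `y ↦ G(m • y - κ)` (`patch_eventuallyEq`), and both sides are continuous, so
the identity extends to the closure (ACM 2019, proof of Lemma 18, Step 1). [folklore] -/
theorem fderiv_lift_patchTorus_of_mem_latticeCell (hm : 0 < m) (hG : ∀ l, ContDiff ℝ 1 (G l))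
    (hW : IsContDiff 1 (patchTorus m ι G)) {κ : d → ℤ} {y : EuclideanSpace ℝ d}
    (hy : y ∈ latticeCell m κ) :
    _root_.fderiv ℝ (lift (patchTorus m ι G)) y =
      (m : ℝ) • _root_.fderiv ℝ (G (ι fun i => κ i % m)) ((m : ℝ) • y - latticeVec κ) := by
  set l : I := ι fun i => κ i % m with hl
  set A : EuclideanSpace ℝ d → EuclideanSpace ℝ d := fun y => (m : ℝ) • y - latticeVec κ with hA
  have hAd : ∀ y, HasFDerivAt A ((m : ℝ) • ContinuousLinearMap.id ℝ _) y := fun y => by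
    simpa [hA] using ((hasFDerivAt_id y).const_smul (m : ℝ)).sub_const (latticeVec κ)
  -- the formula in the open cell
  have hopen : EqOn (_root_.fderiv ℝ (lift (patchTorus m ι G)))
      (fun y => (m : ℝ) • _root_.fderiv ℝ (G l) (A y)) (latticeCellInterior m κ) := by
    intro y hy
    have hev : lift (patchTorus m ι G) =ᶠ[𝓝 y] fun y' => G l (A y') := by
      rw [lift_patchTorus hm]
      exact patch_eventuallyEq hm hy
    rw [hev.fderiv_eq]
    have hc : HasFDerivAt (fun y' => G l (A y'))
        ((_root_.fderiv ℝ (G l) (A y)).comp ((m : ℝ) • ContinuousLinearMap.id ℝ _)) y :=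
      (((hG l).differentiable one_ne_zero) (A y)).hasFDerivAt.comp y (hAd y)
    rw [hc.fderiv]
    ext w
    simp
  -- both sides are continuous
  have hc1 : Continuous (_root_.fderiv ℝ (lift (patchTorus m ι G))) := hW.continuous_fderiv one_ne_zero
  have hAc : Continuous A := (continuous_const_smul (m : ℝ)).sub continuous_const
  have hc2 : Continuous fun y => (m : ℝ) • _root_.fderiv ℝ (G l) (A y) := by
    have hDc := (hG l).continuous_fderiv one_ne_zero
    exact (hDc.comp hAc).const_smul (m : ℝ)
  exact eqOn_latticeCell_of_eqOn_interior hm hc1 hc2 hopen hy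

omit [Fintype d] [DecidableEq d] in
/-- The cell index of a point of the fundamental cube has coordinates in `[0, m)`. [folklore] -/
theorem cellIndex_nonneg_lt_of_mem_unitCube (hm : 0 < m) {y : EuclideanSpace ℝ d}
    (hy : y ∈ unitCube d) (i : d) : 0 ≤ cellIndex m y i ∧ cellIndex m y i < m := by
  have hm' : (0 : ℝ) < m := by exact_mod_cast hm
  rw [cellIndex_apply]
  constructor
  · exact Int.floor_nonneg.2 (mul_nonneg hm'.le (hy i).1)
  · refine Int.floor_lt.2 ?_
    calc (m : ℝ) * y i < m * 1 := mul_lt_mul_of_pos_left (hy i).2 hm'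
      _ = ((m : ℤ) : ℝ) := by simp

/-- **Derivative of a smoothly patched field on the torus**: for `C¹` blocks and `C¹` patched
field, `Torus.fderiv (patchTorus m ι G) x = m • D G_{ι ⌊m y⌋}(cellCoord m y)`, `y = repr x`. [folklore] -/
theorem fderiv_patchTorus (hm : 0 < m) (hG : ∀ l, ContDiff ℝ 1 (G l))
    (hW : IsContDiff 1 (patchTorus m ι G)) (x : UnitAddTorus d) :
    Torus.fderiv (patchTorus m ι G) x =
      (m : ℝ) • _root_.fderiv ℝ (G (ι (cellIndex m (repr x)))) (cellCoord m (repr x)) := by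
  have hy : repr x ∈ latticeCell m (cellIndex m (repr x)) := mem_latticeCell_cellIndex hm _
  have h := fderiv_lift_patchTorus_of_mem_latticeCell hm hG hW hy
  rw [fderiv_lift, proj_repr] at h
  have hidx : (fun i => cellIndex m (repr x) i % (m : ℤ)) = cellIndex m (repr x) := by
    funext i
    obtain ⟨h0, hlt⟩ := cellIndex_nonneg_lt_of_mem_unitCube hm (repr_mem_unitCube x) i
    exact Int.emod_eq_of_lt h0 hlt
  rw [h, cellCoord_of_mem_latticeCell hm hy, hidx]

/-! ## Higher derivatives and the `C^{j,r}` scaling bound -/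

/-- **Derivative bounds for a smoothly patched field.** If the blocks are `Cⁿ` with
`‖Dⁱ G_l(z)‖ ≤ Mᵢ` for `z` in the fundamental cube and `i ≤ n`, and the patched field
`W = patchTorus m ι G` is `Cⁿ` on the torus, then `‖Dⁱ(lift W)(y)‖ ≤ mⁱ Mᵢ` for ALL `y ∈ ℝ^d`
and `i ≤ n`: in the open cells `lift W` is the rescaled block (chain rule,
`norm_iteratedFDeriv_rescale_le`), and the open cells are dense while `Dⁱ(lift W)` is
continuous (ACM 2019, proof of Lemma 18, Step 1, case `p = ∞`). [folklore] -/
theorem norm_iteratedFDeriv_lift_patchTorus_le (hm : 0 < m) {n : ℕ} (hG : ∀ l, ContDiff ℝ n (G l))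
    (hW : IsContDiff n (patchTorus m ι G)) {M : ℕ → ℝ}
    (hM : ∀ i ≤ n, ∀ l, ∀ z ∈ unitCube d, ‖iteratedFDeriv ℝ i (G l) z‖ ≤ M i) {i : ℕ} (hi : i ≤ n)
    (y : EuclideanSpace ℝ d) :
    ‖iteratedFDeriv ℝ i (lift (patchTorus m ι G)) y‖ ≤ (m : ℝ) ^ i * M i := by
  have hm' : (0 : ℝ) < m := by exact_mod_cast hm
  -- continuity of `Dⁱ (lift W)`
  have hcont : Continuous (iteratedFDeriv ℝ i (lift (patchTorus m ι G))) :=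
    hW.continuous_iteratedFDeriv (by exact_mod_cast hi)
  refine norm_le_of_dense_of_continuous hcont (dense_iUnion_latticeCellInterior hm) ?_ y
  intro y hy
  obtain ⟨κ, hκ⟩ := mem_iUnion.1 hy
  set l : I := ι fun j => κ j % m with hl
  -- in the open cell, `lift W` is the rescaled block
  have hev : lift (patchTorus m ι G) =ᶠ[𝓝 y]
      fun y' => (1 : ℝ) • G l ((m : ℝ) • y' - latticeVec κ) := by
    rw [lift_patchTorus hm]
    simpa only [one_smul] using patch_eventuallyEq (ι := fun κ' => ι fun j => κ' j % m) hm hκ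
  rw [(hev.iteratedFDeriv ℝ i).eq_of_nhds]
  refine (norm_iteratedFDeriv_rescale_le (hG l) 1 (m : ℝ) (latticeVec κ) hi y).trans ?_
  rw [abs_one, one_mul, abs_of_pos hm']
  gcongr
  exact hM i hi l _ (smul_sub_latticeVec_mem_unitCube hm (latticeCellInterior_subset hκ))

/-- **`C^{j,r}` scaling bound for a smoothly patched field** (Alberti–Crippa–Mazzucato 2019,
Lemma 18 and Rem. 20 (iii): `‖u(t)‖_{Ẇ^{s,∞}} ≤ C_s λ^{n(… )}`; Bruè–De Lellis 2023, Thm. 4.1 (a),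
(4.10)). If the blocks are `C^{j+1}` with `‖Dⁱ G_l‖ ≤ Mᵢ` on the fundamental cube (`i ≤ j+1`,
`Mᵢ ≥ 0`) and `W = patchTorus m ι G` is `C^{j+1}` on `T^d`, then for `r ≤ 1`:
`‖W‖_{C^{j,r}(T^d)} ≤ m^{j+r} (Σ_{i ≤ j} Mᵢ + M_{j+1} + 2 M_j)`
(derivative bounds `mⁱ Mᵢ` and interpolation at scale `δ = m⁻¹`). [cite: AlbertiCrippaMazzucato2019, Lemma 18] -/
theorem eContDiffHolderNorm_patchTorus_le (hm : 0 < m) {j : ℕ} (hG : ∀ l, ContDiff ℝ (j + 1) (G l))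
    (hW : IsContDiff (j + 1) (patchTorus m ι G)) {M : ℕ → ℝ} (hM0 : ∀ i, 0 ≤ M i)
    (hM : ∀ i ≤ j + 1, ∀ l, ∀ z ∈ unitCube d, ‖iteratedFDeriv ℝ i (G l) z‖ ≤ M i) {r : ℝ≥0}
    (hr : r ≤ 1) :
    eContDiffHolderNorm j r (patchTorus m ι G) ≤
      ENNReal.ofReal ((m : ℝ) ^ ((j : ℝ) + r) *
        ((∑ i ∈ Finset.range (j + 1), M i) + M (j + 1) + 2 * M j)) := by
  have hm' : (0 : ℝ) < m := by exact_mod_cast hm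
  have hm1 : (1 : ℝ) ≤ m := by exact_mod_cast hm
  have hr0 : (0 : ℝ) ≤ r := r.2
  -- derivative bounds `mⁱ Mᵢ` everywhere
  have hD : ∀ i ≤ j + 1, ∀ y, ‖iteratedFDeriv ℝ i (lift (patchTorus m ι G)) y‖ ≤ (m : ℝ) ^ i * M i :=
    fun i hi y => norm_iteratedFDeriv_lift_patchTorus_le hm hG hW hM hi y
  have h := eContDiffHolderNorm_le_of_norm_iteratedFDeriv_le (f := lift (patchTorus m ι G))
    (k := j) hW (M := fun i => (m : ℝ) ^ i * M i) (fun i => mul_nonneg (pow_nonneg hm'.le _) (hM0 i)) hD hr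
    (δ := (m : ℝ)⁻¹) (inv_pos.2 hm')
  refine h.trans (ENNReal.ofReal_le_ofReal ?_)
  -- compare the constants
  have hpow : ∀ i ≤ j, (m : ℝ) ^ i ≤ (m : ℝ) ^ ((j : ℝ) + r) := fun i hi => by
    rw [← Real.rpow_natCast]
    exact Real.rpow_le_rpow_of_exponent_le hm1 (by
      have : (i : ℝ) ≤ j := by exact_mod_cast hi
      linarith)
  have hsum : ∑ i ∈ Finset.range (j + 1), (m : ℝ) ^ i * M i ≤
      (m : ℝ) ^ ((j : ℝ) + r) * ∑ i ∈ Finset.range (j + 1), M i := by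
    rw [Finset.mul_sum]
    refine Finset.sum_le_sum fun i hi => ?_
    have hi' : i ≤ j := by have := Finset.mem_range.1 hi; omega
    exact mul_le_mul_of_nonneg_right (hpow i hi') (hM0 i)
  have htop : (m : ℝ) ^ (j + 1) * M (j + 1) * (m : ℝ)⁻¹ ^ (1 - r : ℝ) =
      (m : ℝ) ^ ((j : ℝ) + r) * M (j + 1) := by
    rw [Real.inv_rpow hm'.le, ← Real.rpow_neg hm'.le, ← Real.rpow_natCast,
      mul_comm ((m : ℝ) ^ ((j + 1 : ℕ) : ℝ)), mul_assoc, ← Real.rpow_add hm']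
    push_cast
    ring_nf
  have hosc : 2 * ((m : ℝ) ^ j * M j) * ((m : ℝ)⁻¹)⁻¹ ^ (r : ℝ) =
      (m : ℝ) ^ ((j : ℝ) + r) * (2 * M j) := by
    rw [inv_inv, ← Real.rpow_natCast, Real.rpow_add hm']
    ring
  calc (∑ i ∈ Finset.range (j + 1), (m : ℝ) ^ i * M i) +
        ((m : ℝ) ^ (j + 1) * M (j + 1) * (m : ℝ)⁻¹ ^ (1 - r : ℝ) +
          2 * ((m : ℝ) ^ j * M j) * ((m : ℝ)⁻¹)⁻¹ ^ (r : ℝ))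
      ≤ (m : ℝ) ^ ((j : ℝ) + r) * ∑ i ∈ Finset.range (j + 1), M i +
          ((m : ℝ) ^ ((j : ℝ) + r) * M (j + 1) + (m : ℝ) ^ ((j : ℝ) + r) * (2 * M j)) := by
        rw [htop, hosc]
        exact add_le_add hsum le_rfl
    _ = (m : ℝ) ^ ((j : ℝ) + r) * ((∑ i ∈ Finset.range (j + 1), M i) + M (j + 1) + 2 * M j) := by
        ring

end Torus

end Literature.Analysis.FunctionSpaces
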